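import Summits.QuantumFields.YangMills.Theorems.TwistedTraceScaling.Negative.CentralEuclideanRadius
import Summits.QuantumFields.YangMills.Theorems.LuscherReductionTwistedTraceScalingLatticeHS
import Summits.QuantumFields.YangMills.Theorems.TwistedTraceScaling.Negative.ValleyGeomExponent
import HarnessLib

/-!
# Negative lemma R47b (cdisprove g39) — the Euclidean radius WINDOW of the landed relative-local (C1) glue
# (crux `TwistedTraceScaling` stmt-QuantumFields-20203, skeleton «twolattice»; vets `…BOCentralTube` §4 = p686369:
# `central_transfer_two_sided_of_localisedAvg_local`)

Consequences of the Euclidean zero `R47.smearedBO_singleLink_eq_zero` (`…Negative.CentralEuclideanRadius`) for the landed glue, which uses ONE scale `T` and ONE radius `R` both for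
`supp Ω` and for the range of centres `v′`:
* §5 `not_hAloAt_singleLink` / `not_hAloLocal_glue_euclid` ★★★: in the glue's own bundled hypotheses, `hAlo` is FALSE for every `gm > 0` once `7·min(ρ, R₀ − R) > 48R + 400T²`
  (Euclidean radius `≈ 7R + 58T²`; compare R46L's sup-norm radius `8.2T`, which the scales of record escape).
* §6 `window_euclid`, `glue_rate_gt`, `glue_rate_gt_of_hAlo` ★★★: `hAlo` with some `gm > 0` (⇒ `7·min(ρ,R₀−R) ≤ 48R + 400T²`) AND an informative lower constant
  (⇒ `min(ρ−2T, R₀−6T²R)²β > |E×3|·log 2 + 98βR²`, `R46L.central_gaussian_tube_lower_local_nonpos`) force `R < 30T²`, `R₀ < 290T²`, `9L³log 2 < 84100·T⁴β`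
  (`T > 0.09·L^{3/4}β^{-1/4}`) and then `coreEta + coreEps1 + coreEps2 > 300·L⁶`: the two displayed constants of the glue differ by a factor `≥ e^{600L⁶}` — for EVERY admissible
  `β, ρ, T, R, R₀, δu ≥ 0, Γ, σ` and every `L ≥ 2`.
READING (a constraint on the unbuilt (C1c′)/(C4) assembly; nothing landed is wrong): the landed one-radius glue is never usefully instantiable — (C1)/S-BASE needs the two constants to
agree to `1 + o(1)` at fixed `L`.  A restatement must DECOUPLE the support radius `R_Ω` (and scales `T_Ω`, `T_W`) from the centre radius `R_c` (lane A's own plan, COARSE-DESIGN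
§28.3 (ii)/§28.6: inner core `R_c ≈ r_f/12…r_f/3`, relative Laplace tail); then `hAlo` can only be asked on `R₀ − R_c < (8/7)(6R_Ω + 2(3T_Ω+2T_W)²)` (certified; `≈ R_Ω − R_c` on paper),
and the tail must be informative with such `m` (volume-dependent threshold `βR_Ω² ≳ L³`, eventually true at fixed `L`: not a kill, cf. Disproof.lean VERDICT).
HONEST FRAMING: negative/boundary lemmas (helper, `--supports stmt-QuantumFields-20203`) about hypotheses of bricks of a stub of a child of the CONDITIONAL reduction route R2b1; nothing
here refutes or proves `TwistedTraceScaling`, S-BASE, (B-OD) or C4-CORE; not infinite volume, not a gap, not Clay. bears_on R2b1.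
-/

set_option autoImplicit false

noncomputable section

open MeasureTheory Filter Topology Real
open scoped BigOperators RealInnerProductSpace Quaternion
open Literature.MathematicalPhysics.QuantumFieldTheory hiding SU2
open Literature.MathematicalPhysics.QuantumLattice

namespace Summit.QuantumFields.YangMills.Theorems.TwistedTraceScaling.Negative.R47W

open Summit.QuantumFields.YangMills.Theorems.FemtoTransferGap
open Summit.QuantumFields.YangMills.Theorems.FemtoTransferGap.TwoLattice
open Summit.QuantumFields.YangMills.Theorems.FemtoTransferGap.TwoLattice.Avg
open Summit.QuantumFields.YangMills.Theorems.FemtoTransferGap.TwoLattice.ConstTube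
open Summit.QuantumFields.YangMills.Theorems.FemtoTransferGap.TwoLattice.Stiff
open Summit.QuantumFields.YangMills.Theorems.FemtoTransferGap.TwoLattice.GnChart
open Summit.QuantumFields.YangMills.Theorems.FemtoTransferGap.TwoLattice.Cov (stepActionErr)
open Summit.QuantumFields.YangMills.Theorems.TwistedTraceScaling.Negative.R45
open Summit.QuantumFields.YangMills.Theorems.TwistedTraceScaling.Negative.R46
open Summit.QuantumFields.YangMills.Theorems.TwistedTraceScaling.Negative.R46L
open Summit.QuantumFields.YangMills.Theorems.TwistedTraceScaling.Negative.R47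
open Literature.MathematicalPhysics.QuantumFieldTheory.Balaban1983to89.T4HaarSU2Translate renaming su2Quat_mul → su2Quat_mul₄, su2Quat_one → su2Quat_one₄
open Literature.MathematicalPhysics.QuantumFieldTheory.Balaban1983to89.T4CubeChartGnomonic (gnoPoint gnoPoint_zero su2Quat_gnoPoint)

variable {L : ℕ} [NeZero L]

/-! ## §5 ★★★ Consequences for the relative-local (C1) glue `…BOCentralTube.central_transfer_two_sided_of_localisedAvg_local` -/

/-- ★★★ **Shifted ball, Euclidean radius.**  Under the glue's support hypotheses (`|v_{e,c}| ≤ T₁` and `‖linkEmbed v‖ ≤ R` on `supp Ω∘linkEmbed`, `‖q(g_x)−1‖ ≤ T₂` on `supp W`),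
for any centre `x′` with `‖x′‖ ≤ R′` and any amplitude `|b| ≤ 1/2` with `6R + 2(3T₁+2T₂)² < (7/8)|b|`, `b² ≤ ρ²`, `|b| + R′ ≤ R₀`: NO `gm > 0` satisfies
`gm·e^{−q(chartVec w)} ≤ A_W(χ₀⊗Ω)(P w)` on `{∀ e, Σ_a w_e a² ≤ ρ²} ∩ {‖chartVec w − x′‖ ≤ R₀}` — the ball contains the single-link zero of `A` (`smearedBO_singleLink_eq_zero`).
Needs a direction `l ≠ k` with `x₁ + e_l ≠ x₁` (any `L ≥ 2`, `R11.shift_ne_self`). [folklore] -/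
theorem not_hAloAt_singleLink {Ω : LinkSpace L → ℝ} {W : (Site 3 L → SU2) → ℝ} {T₁ T₂ R : ℝ}
    (hΩt : ∀ v : Edge 3 L → Fin 3 → ℝ, Ω (linkEmbed L v) ≠ 0 → ∀ e c, |v e c| ≤ T₁)
    (hΩR : ∀ v : Edge 3 L → Fin 3 → ℝ, Ω (linkEmbed L v) ≠ 0 → ‖linkEmbed L v‖ ≤ R)
    (hWc : ∀ g : Site 3 L → SU2, W g ≠ 0 → ∀ x, ‖su2Quat (g x) - 1‖ ≤ T₂)
    (χ₀ : GaugeConfig 3 1 SU2 → ℝ) (x₁ : Site 3 L) {k l : Fin 3} (hkl : k ≠ l) (hl : x₁.shift l ≠ x₁)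
    {b : ℝ} (hb2 : |b| ≤ 1 / 2) (hbig : 6 * R + 2 * (3 * T₁ + 2 * T₂) ^ 2 < 7 / 8 * |b|)
    {ρ R' R₀ : ℝ} (hbρ : b ^ 2 ≤ ρ ^ 2) {x' : LinkSpace L} (hx' : ‖x'‖ ≤ R') (hbR : |b| + R' ≤ R₀) {β gm : ℝ} (hgm : 0 < gm) :
    ¬ ∀ w : Edge 3 L → Fin 3 → ℝ, (∀ e, ∑ a, w e a ^ 2 ≤ ρ ^ 2) → ‖chartVec w - x'‖ ≤ R₀ →
        gm * Real.exp (-stiffGaussExp L (β / 2) β (chartVec w)) ≤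
          ∫ g, W g * boFun L χ₀ Ω (gaugeTransform g⁻¹ (latPatternChart L (fun _ => false) w)) ∂gaugeMeasure L := by
  intro hlo
  -- (the chart-point facts are named first; cf. the elaboration note in `R46.not_localGaussLower_of_twoLink`)
  have P : ∀ e, ∑ a, (Pi.single (x₁, k) (Pi.single (0 : Fin 3) b) : Edge 3 L → Fin 3 → ℝ) e a ^ 2 ≤ ρ ^ 2 :=
    fun e => (singleLink_sum_sq_le x₁ k b e).trans hbρ
  have Q : ‖chartVec (Pi.single (x₁, k) (Pi.single (0 : Fin 3) b) : Edge 3 L → Fin 3 → ℝ) - x'‖ ≤ R₀ :=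
    (norm_sub_le _ _).trans (by rw [norm_chartVec_singleLink]; linarith)
  have h1 := hlo _ P Q
  have hA := smearedBO_singleLink_eq_zero hΩt hΩR hWc χ₀ x₁ hkl hl (hbig.trans_le (norm_su2Quat_gnoPoint_single_sub_one_ge hb2))
  rw [hA] at h1
  exact absurd h1 (not_le.2 (mul_pos hgm (Real.exp_pos _)))

/-- ★★★ **In the parameters of `…BOCentralTube.central_transfer_two_sided_of_localisedAvg_local`** (its bundled support hypotheses `hΩt`, `hWc` with ONE scale `T ≥ 0` and the
Euclidean radius `R ≥ 0` of `supp Ω`; a centre `v′` with `‖linkEmbed v′‖ ≤ R`; chart radius `ρ ≤ 1/2`; `L ≥ 2`): its hypothesis `hAlo` is FALSE for every `gm > 0` as soon as an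
amplitude `b` with `48R + 400T² < 7b`, `b ≤ ρ`, `b + R ≤ R₀` exists — i.e. as soon as `7·min(ρ, R₀ − R) > 48R + 400T²` (`R₀ > 7.86R + 58T²` when `ρ` is not the constraint).
Compare R46L (`(R₀−R)² > (200/3)T²`, the sup-norm/two-link radius `8.2T`): here the radius is EUCLIDEAN, `≈ 7R + 58T²`, and `T` enters only squared. [folklore] -/
theorem not_hAloLocal_glue_euclid {Ω : LinkSpace L → ℝ} {W : (Site 3 L → SU2) → ℝ} {T R Γ : ℝ} (hR0 : 0 ≤ R)
    (hΩt : ∀ v : Edge 3 L → Fin 3 → ℝ, Ω (linkEmbed L v) ≠ 0 → v ∈ capBalancedSet L ∧ (∀ (e : Edge 3 L) (c : Fin 3), |v e c| ≤ T) ∧ ‖linkEmbed L v‖ ≤ R)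
    (hWc : ∀ g : Site 3 L → SU2, W g ≠ 0 → (∀ x, ‖su2Quat (g x) - 1‖ ≤ T) ∧ ‖∑ x, vecPart (g x)‖ ≤ Γ)
    (χ₀ : GaugeConfig 3 1 SU2 → ℝ) (hL : 2 ≤ L) {v' : Edge 3 L → Fin 3 → ℝ} (hx' : ‖linkEmbed L v'‖ ≤ R)
    {ρ R₀ b : ℝ} (hρ2 : ρ ≤ 1 / 2) (hbρ : b ≤ ρ) (hbR₀ : b + R ≤ R₀) (hkill : 48 * R + 400 * T ^ 2 < 7 * b) {β gm : ℝ} (hgm : 0 < gm) :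
    ¬ ∀ w : Edge 3 L → Fin 3 → ℝ, (∀ e, ∑ a, w e a ^ 2 ≤ ρ ^ 2) → ‖chartVec w - linkEmbed L v'‖ ≤ R₀ →
        gm * Real.exp (-stiffGaussExp L (β / 2) β (chartVec w)) ≤
          ∫ g, W g * boFun L χ₀ Ω (gaugeTransform g⁻¹ (latPatternChart L (fun _ => false) w)) ∂gaugeMeasure L := by
  have hb0 : 0 ≤ b := by nlinarith [sq_nonneg T]
  have habs : |b| = b := abs_of_nonneg hb0
  refine not_hAloAt_singleLink (fun v hv => (hΩt v hv).2.1) (fun v hv => (hΩt v hv).2.2) (fun g hg => (hWc g hg).1) χ₀ (0 : Site 3 L) (k := 0) (l := 1)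
    (by decide) (R11.shift_ne_self hL 0 1) (b := b) (by rw [habs]; linarith) (by rw [habs]; nlinarith [sq_nonneg T]) (by nlinarith) hx' (by rw [habs]; exact hbR₀) hgm

/-! ## §6 ★★★ The window: `hAlo` satisfiable AND an informative lower constant force `T > 0.09·L^{3/4}·β^{-1/4}` and a constants' ratio `≥ e^{600·L⁶}` -/

/-- ★★★ **Window, Euclidean form** (pure arithmetic in the parameters of `…central_transfer_two_sided_of_localisedAvg_local`: `β > 0`, `0 ≤ T ≤ 1/30`, `8T ≤ ρ`, `0 ≤ R`,
`6T²R ≤ R₀`).  If `hAlo` holds with some `gm > 0` at some admissible centre — so the kill window of `not_hAloLocal_glue_euclid` is empty: `7·min(ρ, R₀−R) ≤ 48R + 400T²` — and the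
lower constant is informative — so `min(ρ−2T, R₀−6T²R)²β > |E×3|·log 2 + 98βR²` by `R46L.central_gaussian_tube_lower_local_nonpos` — then `R < 30T²`, `R₀ < 290T²` and
`9L³·log 2 < 84100·T⁴·β`, i.e. `T > 0.09·L^{3/4}·β^{-1/4}`: the gauge/sup scale `T` must be POLYNOMIALLY larger than `β^{-1/2}` (the record `T_W ≈ 7.5Lβ^{-1/2}ℓ²` is not). [folklore] -/
theorem window_euclid {β T R R₀ ρ : ℝ} (hβ : 0 < β) (hT0 : 0 ≤ T) (hT : T ≤ 1 / 30) (hTρ : 8 * T ≤ ρ) (hR0 : 0 ≤ R) (hR₀ : 6 * T ^ 2 * R ≤ R₀)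
    (hinfo : Fintype.card (Edge 3 L × Fin 3) * Real.log 2 + 98 * β * R ^ 2 < (min (ρ - 2 * T) (R₀ - 6 * T ^ 2 * R)) ^ 2 * β)
    (hAlo : 7 * min ρ (R₀ - R) ≤ 48 * R + 400 * T ^ 2) :
    R < 30 * T ^ 2 ∧ R₀ < 290 * T ^ 2 ∧ 9 * (L : ℝ) ^ 3 * Real.log 2 < 84100 * T ^ 4 * β := by
  have hc0 : 0 ≤ (Fintype.card (Edge 3 L × Fin 3) : ℝ) * Real.log 2 := mul_nonneg (Nat.cast_nonneg _) (Real.log_nonneg one_le_two)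
  have h1 : 0 ≤ ρ - 2 * T := by linarith
  have h6 : 0 ≤ 6 * T ^ 2 * R := by positivity
  have h2 : 0 ≤ R₀ - 6 * T ^ 2 * R := by linarith
  have hm0 : 0 ≤ min (ρ - 2 * T) (R₀ - 6 * T ^ 2 * R) := le_min h1 h2
  have hmρ : min (ρ - 2 * T) (R₀ - 6 * T ^ 2 * R) ≤ ρ - 2 * T := min_le_left _ _
  have hmR : min (ρ - 2 * T) (R₀ - 6 * T ^ 2 * R) ≤ R₀ - 6 * T ^ 2 * R := min_le_right _ _
  have h98 : 98 * R ^ 2 < (min (ρ - 2 * T) (R₀ - 6 * T ^ 2 * R)) ^ 2 := by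
    by_contra h
    push Not at h
    have := mul_le_mul_of_nonneg_right h hβ.le
    nlinarith
  have h98' : 49 / 5 * R < min (ρ - 2 * T) (R₀ - 6 * T ^ 2 * R) :=
    lt_of_pow_lt_pow_left₀ 2 hm0 (by nlinarith [sq_nonneg R])
  have hT2 : T ^ 2 ≤ T / 30 := by nlinarith [mul_nonneg hT0 (sub_nonneg.2 hT)]
  rcases le_total ρ (R₀ - R) with hcase | hcase
  · rw [min_eq_left hcase] at hAlo
    exfalso
    linarith
  · rw [min_eq_right hcase] at hAlo
    have hA : R < 59 / 2 * T ^ 2 := by linarith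
    have hB : R₀ < 290 * T ^ 2 := by linarith
    have hC : min (ρ - 2 * T) (R₀ - 6 * T ^ 2 * R) < 290 * T ^ 2 := by linarith
    have hC2 : (min (ρ - 2 * T) (R₀ - 6 * T ^ 2 * R)) ^ 2 < (290 * T ^ 2) ^ 2 := pow_lt_pow_left₀ hC hm0 two_ne_zero
    refine ⟨by linarith, hB, ?_⟩
    rw [← card_mul_log_two (L := L)]
    have h5 : 0 ≤ 98 * β * R ^ 2 := by positivity
    have hD := mul_le_mul_of_nonneg_right hC2.le hβ.le
    nlinarith

/-- ★ The (L3) rate of the glue dominates the two step-action quartics: `1401138·|P|·T⁴·β ≤ coreEps2 L β 0 T R σ` (`β, T, σ ≥ 0`). [folklore] -/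
theorem coreEps2_ge {β T R σ : ℝ} (hβ : 0 ≤ β) (hT : 0 ≤ T) (hσ : 0 ≤ σ) :
    1401138 * Fintype.card (Plaquette 3 L) * T ^ 4 * β ≤ coreEps2 L β 0 T R σ := by
  unfold coreEps2 stepActionErr
  simp only [zero_pow two_ne_zero, zero_mul, mul_zero, zero_add, add_zero, Real.sqrt_zero]
  have hP : (0 : ℝ) ≤ Fintype.card (Plaquette 3 L) := Nat.cast_nonneg _
  set P : ℝ := (Fintype.card (Plaquette 3 L) : ℝ) with hPdef
  set A : ℝ := Real.sqrt σ with hA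
  set B : ℝ := σ / 2 * (10 * Real.sqrt (Fintype.card (Plaquette 3 L × Fin 3)) * R) ^ 2 with hB
  have hA0 : 0 ≤ A := Real.sqrt_nonneg _
  have hB0 : 0 ≤ B := by positivity
  have e : 2 * (β / 2 * (B + P * (1728 * T ^ 2 * A + 29376 * T ^ 3 + 700569 * T ^ 4) + P * (29376 * T ^ 3 + 700569 * T ^ 4))) -
      1401138 * P * T ^ 4 * β = β * B + β * P * (1728 * T ^ 2 * A) + 2 * (β * P * (29376 * T ^ 3)) := by ring
  have h1 : 0 ≤ β * B + β * P * (1728 * T ^ 2 * A) + 2 * (β * P * (29376 * T ^ 3)) := by positivity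
  linarith [h1, e]

/-- The other two rates of the glue at `α = δ = 0` are `≥ 0` (`β, T, σ, δu ≥ 0`; `δu ≥ 0` holds as soon as `χ₀ ≢ 0`): `coreEps1 L β 0 T R = 0 ≤ coreEta L β 0 δu T R Γ σ`. [folklore] -/
theorem coreEta_add_coreEps1_nonneg {β δu T R Γ σ : ℝ} (hβ : 0 ≤ β) (hδu : 0 ≤ δu) (hT : 0 ≤ T) (hσ : 0 ≤ σ) :
    0 ≤ coreEta L β 0 δu T R Γ σ + coreEps1 L β 0 T R := by
  unfold coreEta coreEps1 stepActionErr
  have hP : (0 : ℝ) ≤ Fintype.card (Plaquette 3 L) := Nat.cast_nonneg _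
  have hE : (0 : ℝ) ≤ Fintype.card (Edge 3 L) := Nat.cast_nonneg _
  have h3 : (0 : ℝ) ≤ Fintype.card (Plaquette 3 L × Fin 3) := Nat.cast_nonneg _
  have b1 : 0 ≤ β * ((Fintype.card (Edge 3 L) : ℝ) * (558 * δu ^ 2 * T ^ 2 + 192 * δu * T ^ 2)) := by positivity
  have b2 : 0 ≤ β / 2 * (100 * σ * (Fintype.card (Plaquette 3 L × Fin 3) : ℝ) * R ^ 2 +
      2 * ((Fintype.card (Plaquette 3 L) : ℝ) * (1728 * T ^ 2 * Real.sqrt σ + 29376 * T ^ 3 + 700569 * T ^ 4)) +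
      10080 * δu * (Fintype.card (Plaquette 3 L × Fin 3) : ℝ) * R ^ 2) := by positivity
  linarith [b1, b2]

/-- ★★★ **THE LANDED RELATIVE-LOCAL (C1) GLUE IS NEVER UNIFORM.**  In the parameters of `…BOCentralTube.central_transfer_two_sided_of_localisedAvg_local` (`β > 0`, `0 ≤ T ≤ 1/30`,
`8T ≤ ρ`, `0 ≤ R`, `6T²R ≤ R₀`, `σ ≥ 0`): whenever its hypothesis `hAlo` is satisfiable with some `gm > 0` at some admissible centre (kill window of `not_hAloLocal_glue_euclid` empty)
AND its lower constant is informative (`R46L.central_gaussian_tube_lower_local_nonpos`), the rate in its prefactors `e^{∓(coreEta + coreEps1 + coreEps2)}` exceeds `300·L⁶`: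
the displayed upper and lower constants then differ by a factor `≥ e^{600·L⁶}` — for EVERY choice of `β, ρ, T, R, R₀, 0 ≤ δu, Γ, σ` and every `L ≥ 2`.  Since (C1)/S-BASE needs the
two constants to agree to `1 + o(1)` as `β → ∞` at fixed `L`, the glue AS LANDED cannot serve (C1); a restatement must make the local lower comparison `hAlo` live on a ball of radius
`< (zero radius of A) ≈ R_Ω(1+O(T))` around the centre while keeping the Laplace tail informative — e.g. lane A's announced relative-tail upgrade (COARSE-DESIGN §28.6 (c)) with
decoupled scales `R_c ≪ R_Ω`, `T_c, T_Ω ≪ T_W`.  READING: a constraint on the unbuilt (C1c′)/(C1) assembly; nothing landed is wrong. [folklore] -/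
theorem glue_rate_gt {β T R R₀ ρ δu Γ σ : ℝ} (hβ : 0 < β) (hT0 : 0 ≤ T) (hT : T ≤ 1 / 30) (hTρ : 8 * T ≤ ρ) (hR0 : 0 ≤ R) (hR₀ : 6 * T ^ 2 * R ≤ R₀) (hσ : 0 ≤ σ)
    (hδu : 0 ≤ δu)
    (hinfo : Fintype.card (Edge 3 L × Fin 3) * Real.log 2 + 98 * β * R ^ 2 < (min (ρ - 2 * T) (R₀ - 6 * T ^ 2 * R)) ^ 2 * β)
    (hAlo : 7 * min ρ (R₀ - R) ≤ 48 * R + 400 * T ^ 2) :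
    300 * (L : ℝ) ^ 6 < coreEta L β 0 δu T R Γ σ + coreEps1 L β 0 T R + coreEps2 L β 0 T R σ := by
  obtain ⟨-, -, hwin⟩ := window_euclid (L := L) hβ hT0 hT hTρ hR0 hR₀ hinfo hAlo
  have hge := coreEps2_ge (L := L) (R := R) hβ.le hT0 hσ
  have h0 := coreEta_add_coreEps1_nonneg (L := L) (R := R) (Γ := Γ) hβ.le hδu hT0 hσ
  have hP : (Fintype.card (Plaquette 3 L) : ℝ) = 3 * (L : ℝ) ^ 3 := by rw [card_plaquette_three]; push_cast; ring
  rw [hP] at hge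
  have hL3 : 0 < (L : ℝ) ^ 3 := pow_pos (Nat.cast_pos.2 (Nat.pos_of_ne_zero (NeZero.ne L))) 3
  have hlog := Real.log_two_gt_d9
  have key : 9 * (L : ℝ) ^ 3 * 0.6931471803 < 84100 * T ^ 4 * β := lt_of_le_of_lt (by nlinarith) hwin
  nlinarith [mul_lt_mul_of_pos_left key hL3]


/-- ★★★ **The same, from the glue's hypotheses verbatim**: `hΩt`, `hWc`, a centre `v′` with `‖linkEmbed v′‖ ≤ R`, `ρ ≤ 1/2`, `8T ≤ ρ`, `0 ≤ T ≤ 1/30`, `6T²R ≤ R₀`, `σ ≥ 0`,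
`δu ≥ 0`, `L ≥ 2`, and `hAlo` (as stated in `…central_transfer_two_sided_of_localisedAvg_local`) with a POSITIVE `gm`: if the lower constant is informative
(`|E×3|·log 2 + 98βR² < min(ρ−2T, R₀−6T²R)²β`), then `coreEta + coreEps1 + coreEps2 > 300·L⁶`. [folklore] -/
theorem glue_rate_gt_of_hAlo {Ω : LinkSpace L → ℝ} {W : (Site 3 L → SU2) → ℝ} {T R Γ : ℝ}
    (hΩt : ∀ v : Edge 3 L → Fin 3 → ℝ, Ω (linkEmbed L v) ≠ 0 → v ∈ capBalancedSet L ∧ (∀ (e : Edge 3 L) (c : Fin 3), |v e c| ≤ T) ∧ ‖linkEmbed L v‖ ≤ R)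
    (hWc : ∀ g : Site 3 L → SU2, W g ≠ 0 → (∀ x, ‖su2Quat (g x) - 1‖ ≤ T) ∧ ‖∑ x, vecPart (g x)‖ ≤ Γ)
    (χ₀ : GaugeConfig 3 1 SU2 → ℝ) (hL : 2 ≤ L) {v' : Edge 3 L → Fin 3 → ℝ} (hx' : ‖linkEmbed L v'‖ ≤ R)
    {ρ R₀ : ℝ} (hρ2 : ρ ≤ 1 / 2) (hT0 : 0 ≤ T) (hT : T ≤ 1 / 30) (hTρ : 8 * T ≤ ρ) (hR₀ : 6 * T ^ 2 * R ≤ R₀)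
    {β : ℝ} (hβ : 0 < β) {δu σ : ℝ} (hδu : 0 ≤ δu) (hσ : 0 ≤ σ) {gm : ℝ} (hgm : 0 < gm)
    (hAlo : ∀ w : Edge 3 L → Fin 3 → ℝ, (∀ e, ∑ a, w e a ^ 2 ≤ ρ ^ 2) → ‖chartVec w - linkEmbed L v'‖ ≤ R₀ →
        gm * Real.exp (-stiffGaussExp L (β / 2) β (chartVec w)) ≤
          ∫ g, W g * boFun L χ₀ Ω (gaugeTransform g⁻¹ (latPatternChart L (fun _ => false) w)) ∂gaugeMeasure L)
    (hinfo : Fintype.card (Edge 3 L × Fin 3) * Real.log 2 + 98 * β * R ^ 2 < (min (ρ - 2 * T) (R₀ - 6 * T ^ 2 * R)) ^ 2 * β) :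
    300 * (L : ℝ) ^ 6 < coreEta L β 0 δu T R Γ σ + coreEps1 L β 0 T R + coreEps2 L β 0 T R σ := by
  have hR0 : 0 ≤ R := (norm_nonneg _).trans hx'
  have hwin : 7 * min ρ (R₀ - R) ≤ 48 * R + 400 * T ^ 2 := by
    by_contra h
    push Not at h
    exact not_hAloLocal_glue_euclid hR0 hΩt hWc χ₀ hL hx' hρ2 (min_le_left _ _) (by linarith [min_le_right ρ (R₀ - R)]) h hgm hAlo
  exact glue_rate_gt hβ hT0 hT hTρ hR0 hR₀ hσ hδu hinfo hwin

end Summit.QuantumFields.YangMills.Theorems.TwistedTraceScaling.Negative.R47W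

end
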